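import Literature.RingTheory.FormalGroups.FormalGroupHeight
import Mathlib.RingTheory.PowerSeries.Inverse
import HarnessLib

/-!
# The kernel ideal of `[π]_F` for a law of height `h`: `([π]_F(X)) = (X^{q^h})` in `A⟦X⟧`
# ([Hazewinkel 1978] §18.3; [Fröhlich 1968] I §3 Thm. 2; P6 LEAD F0P6-plan M-1b (2))

Topic `Literature/RingTheory/FormalGroups`; namespace `Literature.RingTheory.FormalGroups`.  THEOREMS ONLY (no definition, no named
fact, no instance, no notation, no `sorry`).  Cell `hodgecm-mathlib`, P6 «MOD programme» ROW 4B — LEAD F0P6-plan (g0) M-1b (2) asked that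
the height letters be readable «as an equality of CLOSED SUBSCHEMES ∕ ideals `(([ϖ]_F)(X)) = (X^{q^h})` in `κ̄[[X]]` … so that DICT (c3) can
read `ker [ϖ] = ker F_{q^h}` off it literally».  This file derives exactly that from the ★ HEIGHT NORMAL FORMS
`FormalOModuleLaw.IsOfHeight` (p844456: `[π]_F(T) = u(T^{q^h})`, `u(0) = 0`, `u₁ ∈ Aˣ`) and `IsOfPHeight` (`FormalGroupHeight`, `[p]_F`).

## Contents

* `exists_isUnit_X_pow_mul_of_subst_X_pow` — the series algebra: if `u(0) = 0` and `u₁` is a unit then `u(X^k) = X^k · w` with `w` a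
  UNIT of `A⟦X⟧` (`w(0) = u₁`), `k ≥ 1`; hence `span {u(X^k)} = span {X^k}`.
* `FormalOModuleLaw.span_act_eq_span_X_pow` — `IsOfHeight M π q h ⇒ Ideal.span {[π]_F} = Ideal.span {X^{q^h}}` («`ker [π]_F = ker Frob_{q^h}`
  as closed formal subschemes of `Spf A⟦X⟧`, i.e. as ideals»); `FormalOModuleLaw.exists_isUnit_act_eq_X_pow_mul`.
* `span_nsmulHom_eq_span_X_pow` — the same for `IsOfPHeight F p h` and `[p]_F`.

Deliberately NOT here: the converse (an ideal identity does not give the normal form `u(X^{q^h})` back without a Frobenius argument),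
scheme-theoretic packaging (`Spec A[X]⧸(X^{q^h})`), Frobenius kernels of formal groups as group subschemes.
-/

noncomputable section

namespace Literature.RingTheory.FormalGroups

universe u v

variable {A : Type u} [CommRing A]

/-! ## §1 Series algebra: `u(X^k) = X^k · (unit)` -/

/-- If `u ∈ X·A⟦X⟧` has UNIT linear coefficient then `u(X^k) = X^k · w` for a unit `w` of `A⟦X⟧` (indeed `w = u′(X^k)` with `u = X·u′`,
`w(0) = u₁`), for `k ≠ 0`. [cite: Hazewinkel1978, §18.3 Def. (18.3.3)] -/
theorem exists_isUnit_X_pow_mul_of_subst_X_pow {u : PowerSeries A} (hu0 : PowerSeries.constantCoeff u = 0)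
    (hu1 : IsUnit (PowerSeries.coeff 1 u)) {k : ℕ} (hk : k ≠ 0) :
    ∃ w : PowerSeries A, IsUnit w ∧ PowerSeries.subst ((PowerSeries.X : PowerSeries A) ^ k) u = PowerSeries.X ^ k * w := by
  obtain ⟨u', rfl⟩ : PowerSeries.X ∣ u := PowerSeries.X_dvd_iff.mpr hu0
  have hX : PowerSeries.HasSubst ((PowerSeries.X : PowerSeries A) ^ k) := PowerSeries.HasSubst.X_pow hk
  refine ⟨PowerSeries.subst (PowerSeries.X ^ k) u', ?_, ?_⟩
  · rw [PowerSeries.isUnit_iff_constantCoeff, PowerSeries.constantCoeff_subst_X_pow hk]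
    rwa [PowerSeries.coeff_succ_X_mul, PowerSeries.coeff_zero_eq_constantCoeff_apply] at hu1
  · rw [PowerSeries.subst_mul hX, PowerSeries.subst_X hX]

/-- Hence the principal ideals agree: `(u(X^k)) = (X^k)` in `A⟦X⟧`. [cite: Hazewinkel1978, §18.3 Def. (18.3.3)] -/
theorem span_subst_X_pow_eq {u : PowerSeries A} (hu0 : PowerSeries.constantCoeff u = 0) (hu1 : IsUnit (PowerSeries.coeff 1 u))
    {k : ℕ} (hk : k ≠ 0) :
    Ideal.span {PowerSeries.subst ((PowerSeries.X : PowerSeries A) ^ k) u} = Ideal.span {(PowerSeries.X : PowerSeries A) ^ k} := by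
  obtain ⟨w, hw, h⟩ := exists_isUnit_X_pow_mul_of_subst_X_pow hu0 hu1 hk
  rw [h, Ideal.span_singleton_mul_right_unit hw]

/-! ## §2 The kernel ideal of `[π]_F` for a formal `𝒪`-module law of height `h` -/

namespace FormalOModuleLaw

variable {𝒪 : Type v} [CommRing 𝒪] [Algebra 𝒪 A]

/-- **`[π]_F(X) = X^{q^h} · w`, `w` a unit**, for a formal `𝒪`-module law of height `h` (`q^h ≠ 0`). [cite: Hazewinkel1978, §18.3] -/
theorem exists_isUnit_act_eq_X_pow_mul {M : FormalOModuleLaw 𝒪 A} {π : 𝒪} {q h : ℕ} (hM : M.IsOfHeight π q h) (hqh : q ^ h ≠ 0) :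
    ∃ w : PowerSeries A, IsUnit w ∧ (M.act π).toPowerSeries = PowerSeries.X ^ (q ^ h) * w := by
  obtain ⟨u, hu0, hu1, hu⟩ := hM
  obtain ⟨w, hw, h⟩ := exists_isUnit_X_pow_mul_of_subst_X_pow hu0 hu1 hqh
  exact ⟨w, hw, hu.trans h⟩

/-- **The kernel ideal identity `([π]_F(X)) = (X^{q^h})` in `A⟦X⟧`** for a formal `𝒪`-module law of height `h` — «`ker [π]_F = ker F_{q^h}`
as closed subschemes of `Spf A⟦X⟧`» read as ideals (P6 LEAD M-1b (2)). [cite: Hazewinkel1978, §18.3] [cite: Frohlich1968, Ch. I §3 Thm. 2] -/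
theorem span_act_eq_span_X_pow {M : FormalOModuleLaw 𝒪 A} {π : 𝒪} {q h : ℕ} (hM : M.IsOfHeight π q h) (hqh : q ^ h ≠ 0) :
    Ideal.span {(M.act π).toPowerSeries} = Ideal.span {(PowerSeries.X : PowerSeries A) ^ (q ^ h)} := by
  obtain ⟨u, hu0, hu1, hu⟩ := hM
  rw [hu, span_subst_X_pow_eq hu0 hu1 hqh]

/-- Consequently `X^{q^h}` DIVIDES `[π]_F` and `[π]_F` divides `X^{q^h}`. [cite: Hazewinkel1978, §18.3] -/
theorem X_pow_dvd_act_and_act_dvd_X_pow {M : FormalOModuleLaw 𝒪 A} {π : 𝒪} {q h : ℕ} (hM : M.IsOfHeight π q h) (hqh : q ^ h ≠ 0) :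
    (PowerSeries.X : PowerSeries A) ^ (q ^ h) ∣ (M.act π).toPowerSeries ∧
      (M.act π).toPowerSeries ∣ (PowerSeries.X : PowerSeries A) ^ (q ^ h) := by
  have h := span_act_eq_span_X_pow hM hqh
  exact ⟨Ideal.mem_span_singleton.mp (h ▸ Ideal.mem_span_singleton_self _),
    Ideal.mem_span_singleton.mp (h.symm ▸ Ideal.mem_span_singleton_self _)⟩

end FormalOModuleLaw

/-! ## §3 The same for the `p`-height of a law -/

/-- **`([p]_F(X)) = (X^{p^h})` in `A⟦X⟧`** for a commutative law of `p`-height `h` (`p^h ≠ 0`). [cite: Hazewinkel1978, §18.3] -/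
theorem span_nsmulHom_eq_span_X_pow {F : FormalGroup A} [F.IsComm] {p h : ℕ} (hF : IsOfPHeight F p h) (hph : p ^ h ≠ 0) :
    Ideal.span {(FormalGroupHom.nsmulHom F p).toPowerSeries} = Ideal.span {(PowerSeries.X : PowerSeries A) ^ (p ^ h)} := by
  obtain ⟨u, hu0, hu1, hu⟩ := hF
  rw [hu, span_subst_X_pow_eq hu0 hu1 hph]

/-- `[p]_F(X) = X^{p^h} · w` with `w` a unit, for a commutative law of `p`-height `h`. [cite: Hazewinkel1978, §18.3] -/
theorem exists_isUnit_nsmulHom_eq_X_pow_mul {F : FormalGroup A} [F.IsComm] {p h : ℕ} (hF : IsOfPHeight F p h) (hph : p ^ h ≠ 0) :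
    ∃ w : PowerSeries A, IsUnit w ∧ (FormalGroupHom.nsmulHom F p).toPowerSeries = PowerSeries.X ^ (p ^ h) * w := by
  obtain ⟨u, hu0, hu1, hu⟩ := hF
  obtain ⟨w, hw, h⟩ := exists_isUnit_X_pow_mul_of_subst_X_pow hu0 hu1 hph
  exact ⟨w, hw, hu.trans h⟩

end Literature.RingTheory.FormalGroups
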